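import Mathlib
import Summits.CriticalPhenomena.PercolationContinuityZ3.Theorems.PercNearOneGluingNoHeavyLowerTailKnQuestion8CoefficientwiseHarris
import HarnessLib

/-!
# The antithetic (two-colouring) kernel: odd pairing, product kernels, and the frameless coefficientwise PAC inequality

Support file (`--supports stmt-CriticalPhenomena-4575`, closed crux; independent mathematics of the KN Question 8 programme),
prover `prim-ineq-gen-7` gen 17.  No definitions, no named facts, no sorries; standard axioms.
Memo `run/shared/lean/prim/prim-ineq-gen-7/FINDING-ANTITHETIC-g17.md` §1–§2.

**Setting.**  A two-copy ("coefficientwise", "fibrewise", "antipodal") inequality for Bernoulli percolation is a statement about the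
uniform two-colouring `s ⊆ ι` (red) / `sᶜ` (blue) of the edge set `ι` of every minor.  All such statements that are currently census-clean
(prim-ineq-gen-1's A-BHK, prim-lf-2's CW-PA, prim-cplus' DOM, prim-ineq-gen-7 g16's CW-vdBK / CW-vdBHK / TWO-SOURCE / dom0 / dom1) are
instances of ONE conjecture (MASTER⁺ of the memo): for the measure-preserving involution `ι = compl` and any two functions `w₁, w₂` that are
monotone in the *doubled* order (red source-cluster up, red target-cluster down, blue source-cluster down, blue target-cluster up), restricted
to the two-sided frame, `Σ (w₁ s − w₁ sᶜ)(w₂ s − w₂ sᶜ) ≥ 0`.  This file records the elementary algebra of that kernel and proves its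
frameless four-pattern instance:
* `AntitheticProduct.kernel_expand` — `Σ (w₁ − w₁∘ι)(w₂ − w₂∘ι) = 2 Σ (w₁ w₂ − w₁ · w₂∘ι)` for an involution `ι` of a finite type;
* `AntitheticProduct.odd_pairing` — for `ι`-odd `ψ`, `Σ w ψ = ½ Σ (w − w∘ι) ψ` ("positive association for odd observables" is the same
  statement as the kernel inequality);
* `AntitheticProduct.product_kernel` — for `w₁ = a (1 − a∘ι)`, `w₂ = b (1 − b∘ι)`:
  `Σ (w₁ − w₁∘ι)(w₂ − w₂∘ι) = 2 Σ [ a b · ((1−a)(1−b))∘ι − a(1−b) · ((1−a) b)∘ι ]` — the four-pattern ("dom") kernels are antithetic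
  product kernels;
* `AntitheticProduct.frameless_cwPAC` — for antitone `a, b : Finset ι → ℝ` with values in `[0,1]`,
  `Σ_s a s (1 − b s) (1 − a sᶜ) b sᶜ ≤ Σ_s a s b s (1 − a sᶜ)(1 − b sᶜ)`.
  With `a = 1{o ↮ {x,v}}`, `b = 1{x ↮ {o,v}}` (antitone in the open edge set) the four products are the indicators of the atoms
  `PV = {x~v, o isolated}`, `E = {o~v, x isolated}`, `PM = {x,o,v pairwise separated}`, `O = {x~o}` of prim-ineq-gen-7 g12–g16, and the
  inequality is `#{s : s ∈ E, sᶜ ∈ PV} ≤ #{s : s ∈ PM, sᶜ ∈ O}` on every finite multigraph — the COEFFICIENTWISE form of the frame-free PAC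
  inequality `μ(E)μ(PV) ≤ μ(PM)μ(O)` (g12 `(α)` at `Y = ∅`), i.e. conjecture dom0 of g16 (memo FINDING-MPHI-g16 §6f) without the frame; proof =
  prim-lf-2's `Coefficientwise.harris_twoColouring` applied to the two antitone products, plus `product_kernel`.
[cite: KozmaNitzan2024, Questions 8–9 (§5.5 p. 36) (context)]
-/

namespace Summit.CriticalPhenomena.PercolationContinuityZ3.Theorems

open Finset

namespace AntitheticProduct

section Abstract

variable {Ω : Type*} [Fintype Ω]

/-- Expansion of the antithetic kernel: for an involution `ι` of a finite type and any `w₁, w₂`,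
`Σ (w₁ x − w₁ (ι x)) (w₂ x − w₂ (ι x)) = 2 Σ (w₁ x w₂ x − w₁ x w₂ (ι x))`. [this work] -/
theorem kernel_expand (ι : Ω ≃ Ω) (hι : ∀ x, ι (ι x) = x) (w₁ w₂ : Ω → ℝ) :
    ∑ x, (w₁ x - w₁ (ι x)) * (w₂ x - w₂ (ι x)) = 2 * ∑ x, (w₁ x * w₂ x - w₁ x * w₂ (ι x)) := by
  have e1 : ∑ x, w₁ (ι x) * w₂ (ι x) = ∑ x, w₁ x * w₂ x :=
    Fintype.sum_equiv ι _ _ (fun x => rfl)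
  have e2 : ∑ x, w₁ (ι x) * w₂ x = ∑ x, w₁ x * w₂ (ι x) := by
    refine Fintype.sum_equiv ι _ _ (fun x => ?_)
    rw [hι]
  have : ∀ x, (w₁ x - w₁ (ι x)) * (w₂ x - w₂ (ι x)) =
      w₁ x * w₂ x + w₁ (ι x) * w₂ (ι x) - w₁ x * w₂ (ι x) - w₁ (ι x) * w₂ x := fun x => by ring
  simp only [this, Finset.sum_sub_distrib, Finset.sum_add_distrib, e1, e2]
  ring

/-- Odd pairing: if `ψ` is odd under the involution `ι` then `Σ w ψ = ½ Σ (w − w∘ι) ψ` for every `w`.  Hence "`E[w ψ] ≥ 0` for all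
monotone `w` and all odd monotone `ψ`" and "`Σ (w₁ − w₁∘ι)(w₂ − w₂∘ι) ≥ 0` for all monotone `w₁, w₂`" are the same statement. [this work] -/
theorem odd_pairing (ι : Ω ≃ Ω) (w ψ : Ω → ℝ) (hψ : ∀ x, ψ (ι x) = -ψ x) :
    ∑ x, w x * ψ x = (1 / 2) * ∑ x, (w x - w (ι x)) * ψ x := by
  have e : ∑ x, w (ι x) * ψ x = -∑ x, w x * ψ x := by
    have h1 : ∑ x, w (ι x) * ψ x = ∑ x, w (ι x) * (-ψ (ι x)) := by
      refine Finset.sum_congr rfl (fun x _ => ?_)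
      rw [hψ x]; ring
    rw [h1]
    have h2 : ∑ x, w (ι x) * (-ψ (ι x)) = ∑ x, w x * (-ψ x) :=
      Fintype.sum_equiv ι _ _ (fun x => rfl)
    rw [h2]
    simp [Finset.sum_neg_distrib]
  have : ∑ x, (w x - w (ι x)) * ψ x = ∑ x, w x * ψ x - ∑ x, w (ι x) * ψ x := by
    rw [← Finset.sum_sub_distrib]
    refine Finset.sum_congr rfl (fun x _ => by ring)
  rw [this, e]
  ring

/-- Product kernels: for `w₁ = a·(1 − a∘ι)`, `w₂ = b·(1 − b∘ι)` the antithetic kernel is twice the four-pattern difference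
`Σ [a b · ((1−a)(1−b))∘ι − a(1−b) · ((1−a)b)∘ι]`. [this work] -/
theorem product_kernel (ι : Ω ≃ Ω) (hι : ∀ x, ι (ι x) = x) (a b : Ω → ℝ) :
    ∑ x, ((a x * (1 - a (ι x))) - (a (ι x) * (1 - a (ι (ι x))))) * ((b x * (1 - b (ι x))) - (b (ι x) * (1 - b (ι (ι x))))) =
      2 * ∑ x, (a x * b x * ((1 - a (ι x)) * (1 - b (ι x))) - a x * (1 - b x) * ((1 - a (ι x)) * b (ι x))) := by
  have h := kernel_expand ι hι (fun x => a x * (1 - a (ι x))) (fun x => b x * (1 - b (ι x)))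
  rw [h]
  congr 1
  refine Finset.sum_congr rfl (fun x _ => ?_)
  rw [hι]
  ring

end Abstract

section Cube

variable {ι : Type*} [Fintype ι] [DecidableEq ι]

/-- On the Boolean lattice: if `a` is antitone with `0 ≤ a ≤ 1` then `s ↦ a s · (1 − a sᶜ)` is antitone. [this work] -/
theorem antitone_mul_one_sub_compl (a : Finset ι → ℝ) (ha : Antitone a) (ha0 : ∀ s, 0 ≤ a s) (ha1 : ∀ s, a s ≤ 1) :
    Antitone (fun s : Finset ι => a s * (1 - a sᶜ)) := by
  intro s t hst
  have h1 : a t ≤ a s := ha hst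
  have h2 : a sᶜ ≤ a tᶜ := ha (compl_subset_compl.mpr hst)
  have h3 : 0 ≤ 1 - a sᶜ := by linarith [ha1 sᶜ]
  have h4 : 0 ≤ a t := ha0 t
  calc a t * (1 - a tᶜ) ≤ a t * (1 - a sᶜ) := by
        apply mul_le_mul_of_nonneg_left _ h4; linarith
    _ ≤ a s * (1 - a sᶜ) := by
        apply mul_le_mul_of_nonneg_right h1 h3

/-- **Frameless coefficientwise PAC** (conjecture dom0 of prim-ineq-gen-7 g16 at `Y = ∅`).  For antitone `a, b : Finset ι → ℝ` with values
in `[0,1]`:  `Σ_s a s (1 − b s) (1 − a sᶜ) b sᶜ ≤ Σ_s a s b s (1 − a sᶜ)(1 − b sᶜ)`.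
Percolation reading (`a = 1{o ↮ {x,v}}`, `b = 1{x ↮ {o,v}}` on a finite multigraph with edge set `ι`, `s` = open edges):
`#{s : s ∈ E, sᶜ ∈ PV} ≤ #{s : s ∈ PM, sᶜ ∈ O}`, the pair-profile coefficients of `μ(PM)μ(O) − μ(E)μ(PV)`; in particular
`μ_p(E)μ_p(PV) ≤ μ_p(PM)μ_p(O)` for every product measure.  Proof: `Coefficientwise.harris_twoColouring` for the monotone functions
`−a(1−a∘compl)`, `−b(1−b∘compl)` and `product_kernel`. [new] -/
theorem frameless_cwPAC (a b : Finset ι → ℝ) (ha : Antitone a) (hb : Antitone b)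
    (ha0 : ∀ s, 0 ≤ a s) (ha1 : ∀ s, a s ≤ 1) (hb0 : ∀ s, 0 ≤ b s) (hb1 : ∀ s, b s ≤ 1) :
    ∑ s : Finset ι, a s * (1 - b s) * ((1 - a sᶜ) * b sᶜ) ≤ ∑ s : Finset ι, a s * b s * ((1 - a sᶜ) * (1 - b sᶜ)) := by
  set w₁ : Finset ι → ℝ := fun s => a s * (1 - a sᶜ) with hw₁
  set w₂ : Finset ι → ℝ := fun s => b s * (1 - b sᶜ) with hw₂
  have m₁ : Monotone (fun s => -w₁ s) := fun s t hst => by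
    have := antitone_mul_one_sub_compl a ha ha0 ha1 hst; simp only [hw₁]; linarith
  have m₂ : Monotone (fun s => -w₂ s) := fun s t hst => by
    have := antitone_mul_one_sub_compl b hb hb0 hb1 hst; simp only [hw₂]; linarith
  have hH := Coefficientwise.harris_twoColouring (fun s => -w₁ s) (fun s => -w₂ s) m₁ m₂
  -- the compl involution as an Equiv
  let cpl : Finset ι ≃ Finset ι := ⟨compl, compl, fun s => compl_compl s, fun s => compl_compl s⟩
  have hcplapp : ∀ s : Finset ι, cpl s = sᶜ := fun s => rfl
  have hcpl : ∀ s : Finset ι, cpl (cpl s) = s := fun s => by rw [hcplapp, hcplapp, compl_compl]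
  have hP := product_kernel cpl hcpl a b
  simp only [hcplapp, compl_compl] at hP
  have e1 : ∑ s : Finset ι, (-w₁ s - -w₁ sᶜ) * (-w₂ s - -w₂ sᶜ) =
      ∑ s : Finset ι, ((a s * (1 - a sᶜ)) - (a sᶜ * (1 - a s))) * ((b s * (1 - b sᶜ)) - (b sᶜ * (1 - b s))) := by
    refine Finset.sum_congr rfl (fun s _ => ?_)
    simp only [hw₁, hw₂, compl_compl]
    ring
  rw [e1, hP] at hH
  have e2 : ∑ s : Finset ι, (a s * b s * ((1 - a sᶜ) * (1 - b sᶜ)) - a s * (1 - b s) * ((1 - a sᶜ) * b sᶜ)) =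
      ∑ s : Finset ι, a s * b s * ((1 - a sᶜ) * (1 - b sᶜ)) - ∑ s : Finset ι, a s * (1 - b s) * ((1 - a sᶜ) * b sᶜ) := by
    rw [← Finset.sum_sub_distrib]
  rw [e2] at hH
  linarith

end Cube


section Gluing

variable {ι : Type*} [Fintype ι] [DecidableEq ι] {Y : Type*}

/-- Half of the two-colouring Harris inequality in "odd-pairing" form: for monotone `f, g` on the Boolean lattice,
`0 ≤ Σ_s f s · (g s − g sᶜ)` (= ½ · `Coefficientwise.harris_twoColouring` by `kernel_expand`). [this work] -/
theorem sum_mul_sub_compl_nonneg (f g : Finset ι → ℝ) (hf : Monotone f) (hg : Monotone g) :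
    0 ≤ ∑ s : Finset ι, f s * (g s - g sᶜ) := by
  have hH := Coefficientwise.harris_twoColouring f g hf hg
  let cpl : Finset ι ≃ Finset ι := ⟨compl, compl, fun s => compl_compl s, fun s => compl_compl s⟩
  have hcpl : ∀ s : Finset ι, cpl (cpl s) = s := fun s => compl_compl s
  have hK := kernel_expand cpl hcpl f g
  have e1 : ∑ s : Finset ι, (f s - f (cpl s)) * (g s - g (cpl s)) = ∑ s : Finset ι, (f s - f sᶜ) * (g s - g sᶜ) :=
    Finset.sum_congr rfl (fun s _ => rfl)
  have e2 : ∑ s : Finset ι, (f s * g s - f s * g (cpl s)) = ∑ s : Finset ι, f s * (g s - g sᶜ) :=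
    Finset.sum_congr rfl (fun s _ => by show f s * g s - f s * g sᶜ = f s * (g s - g sᶜ); ring)
  rw [e1, e2] at hK
  rw [hK] at hH
  linarith

/-- **Root gluing / cube factor** (the "separated" case of MASTER⁺ for a principal generator).  Let the colourings of one block
range over the full cube `Finset ι` and the rest of the configuration over a finite set `Ω ⊆ Y` invariant under an involution `θ`
(dictionary: `ι` = the edges of the component of `G − x` containing the vertex `a` when that component does NOT contain `T`; `Y` = colourings
of the other components, `Ω` = those satisfying the two-sided frame, `θ` = colour swap; `f s = 1{a ∈ V(ρ(s))}·1{a ∉ V(ρ(sᶜ))}` — "`a` is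
red-reached and not blue-reached from `x`" — is monotone in the block colouring `s`; `G s y = w₂(doubled state)` is monotone in `s` for every `y`
because the block contributes `(ρ(s) ↑, ρ(sᶜ) ↓)` to the doubled order).  Then `Σ_s Σ_{y∈Ω} f s (G s y − G sᶜ (θ y)) ≥ 0`, i.e.
`Σ_{Ω_T} (1{a ∈ K(U)} − 1{a ∈ K(Ū)})·w₂(U) ≥ 0` in that case: the principal antithetic inequality holds whenever `x` separates `a` from `T`
(memo FINDING-ANTITHETIC-g17 §1f; lf-2 CW-REDUCTION §16 for the factorisation).  Proof: reindex the `θ y` sum over the `θ`-invariant `Ω` and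
apply `sum_mul_sub_compl_nonneg` to `f` and `s ↦ Σ_{y∈Ω} G s y`. [this work] -/
theorem cube_factor_nonneg (θ : Y ≃ Y) (Ω : Finset Y) (hΩ : ∀ y, θ y ∈ Ω ↔ y ∈ Ω)
    (f : Finset ι → ℝ) (hf : Monotone f) (G : Finset ι → Y → ℝ) (hG : ∀ y, Monotone (fun s => G s y)) :
    0 ≤ ∑ s : Finset ι, ∑ y ∈ Ω, f s * (G s y - G sᶜ (θ y)) := by
  -- reindex the θ-shifted sum
  have reidx : ∀ s : Finset ι, ∑ y ∈ Ω, G sᶜ (θ y) = ∑ y ∈ Ω, G sᶜ y := by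
    intro s
    refine Finset.sum_bij (fun y _ => θ y) (fun y hy => (hΩ y).2 hy) (fun y₁ _ y₂ _ h => θ.injective h)
      (fun y hy => ⟨θ.symm y, (hΩ (θ.symm y)).1 (by simpa using hy), by simp⟩) (fun y _ => rfl)
  set Gs : Finset ι → ℝ := fun s => ∑ y ∈ Ω, G s y with hGs
  have hGsm : Monotone Gs := by
    intro s t hst
    simp only [hGs]
    exact Finset.sum_le_sum (fun y _ => hG y hst)
  have e : ∑ s : Finset ι, ∑ y ∈ Ω, f s * (G s y - G sᶜ (θ y)) = ∑ s : Finset ι, f s * (Gs s - Gs sᶜ) := by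
    refine Finset.sum_congr rfl (fun s _ => ?_)
    rw [← Finset.mul_sum, Finset.sum_sub_distrib, reidx s]
  rw [e]
  exact sum_mul_sub_compl_nonneg f Gs hf hGsm

end Gluing

section AntipodalKleitman

/-!
### Antipodal Kleitman structures and their products (gen 17, Theorem PC of the memo)

An *antipodal Kleitman* (AK) structure is a finite preordered type `P` with a weight `μ ≥ 0` and a self-map `ι` (in the applications an
order-reversing, `μ`-preserving involution) such that `Σ_p μ p · f p · (g p − g (ι p)) ≥ 0` for all monotone `f, g : P → ℝ`; for indicators
of up-sets `A, B` this reads `μ(A ∩ B) ≥ μ(A ∩ ι B)`.  MASTER⁺ for `(G;S,T)` is the statement that the frame poset `(Ω_T, ≼, counting, colour-swap)`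
is AK.  The Boolean lattice with `ι = compl` is AK (`Coefficientwise.harris_twoColouring`, `sum_mul_sub_compl_nonneg` above); the theorem below
says AK is closed under products (product preorder, product weight, product map).  Consequence (memo §1h, Theorem PC): for a theta graph with
poles `x, t` the frame poset is the product of the arcs' run posets, each of which is a disjoint union of `ι`-invariant constant-weight Boolean
blocks, hence AK — MASTER⁺ holds for all paths (S,T the endpoints), all cycles (any `x,t`) and all theta graphs (poles).
-/

variable {P₁ P₂ : Type*} [Fintype P₁] [Fintype P₂] [Preorder P₁] [Preorder P₂]

/-- **Products of antipodal Kleitman structures are antipodal Kleitman.**  If `Σ_p μ₁ p f p (g p − g (ι₁ p)) ≥ 0` for all monotone `f, g`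
on `P₁`, and likewise on `P₂`, then `Σ_{p,q} μ₁ p μ₂ q f (p,q) (g (p,q) − g (ι₁ p, ι₂ q)) ≥ 0` for all `f, g` monotone on `P₁ × P₂` (product order).
Proof: `g(p,q) − g(ι₁p, ι₂q) = [g(p,q) − g(ι₁p,q)] + [g(ι₁p,q) − g(ι₁p,ι₂q)]`; the first bracket is handled by `P₁` for each fixed `q`, the second by
`P₂` for each fixed `p` (with the monotone section `g(ι₁ p, ·)`). [this work] -/
theorem antipodalKleitman_prod (μ₁ : P₁ → ℝ) (μ₂ : P₂ → ℝ) (hμ₁ : ∀ p, 0 ≤ μ₁ p) (hμ₂ : ∀ q, 0 ≤ μ₂ q) (ι₁ : P₁ → P₁) (ι₂ : P₂ → P₂)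
    (h₁ : ∀ f g : P₁ → ℝ, Monotone f → Monotone g → 0 ≤ ∑ p, μ₁ p * (f p * (g p - g (ι₁ p))))
    (h₂ : ∀ f g : P₂ → ℝ, Monotone f → Monotone g → 0 ≤ ∑ q, μ₂ q * (f q * (g q - g (ι₂ q))))
    (f g : P₁ × P₂ → ℝ) (hf : Monotone f) (hg : Monotone g) :
    0 ≤ ∑ pq : P₁ × P₂, μ₁ pq.1 * μ₂ pq.2 * (f pq * (g pq - g (ι₁ pq.1, ι₂ pq.2))) := by
  -- monotone sections
  have fsec1 : ∀ q, Monotone (fun p => f (p, q)) := fun q p p' h => hf (Prod.mk_le_mk.2 ⟨h, le_rfl⟩)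
  have gsec1 : ∀ q, Monotone (fun p => g (p, q)) := fun q p p' h => hg (Prod.mk_le_mk.2 ⟨h, le_rfl⟩)
  have fsec2 : ∀ p, Monotone (fun q => f (p, q)) := fun p q q' h => hf (Prod.mk_le_mk.2 ⟨le_rfl, h⟩)
  have gsec2 : ∀ p, Monotone (fun q => g (p, q)) := fun p q q' h => hg (Prod.mk_le_mk.2 ⟨le_rfl, h⟩)
  -- split the difference
  have split : ∀ pq : P₁ × P₂, μ₁ pq.1 * μ₂ pq.2 * (f pq * (g pq - g (ι₁ pq.1, ι₂ pq.2))) =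
      μ₂ pq.2 * (μ₁ pq.1 * (f (pq.1, pq.2) * (g (pq.1, pq.2) - g (ι₁ pq.1, pq.2)))) +
      μ₁ pq.1 * (μ₂ pq.2 * (f (pq.1, pq.2) * (g (ι₁ pq.1, pq.2) - g (ι₁ pq.1, ι₂ pq.2)))) := by
    rintro ⟨p, q⟩; ring
  rw [Finset.sum_congr rfl (fun pq _ => split pq), Finset.sum_add_distrib]
  apply add_nonneg
  · -- first bracket: for each q, P₁'s inequality
    rw [← Finset.univ_product_univ, Finset.sum_product_right]
    refine Finset.sum_nonneg (fun q _ => ?_)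
    dsimp only
    rw [← Finset.mul_sum]
    exact mul_nonneg (hμ₂ q) (h₁ (fun p => f (p, q)) (fun p => g (p, q)) (fsec1 q) (gsec1 q))
  · -- second bracket: for each p, P₂'s inequality with the section g(ι₁ p, ·)
    rw [← Finset.univ_product_univ, Finset.sum_product]
    refine Finset.sum_nonneg (fun p _ => ?_)
    dsimp only
    rw [← Finset.mul_sum]
    exact mul_nonneg (hμ₁ p) (h₂ (fun q => f (p, q)) (fun q => g (ι₁ p, q)) (fsec2 p) (gsec2 (ι₁ p)))

/-- The Boolean lattice `Finset ι` with the counting weight and `ι = compl` is an antipodal Kleitman structure (restatement of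
`sum_mul_sub_compl_nonneg` in the format of `antipodalKleitman_prod`). [this work] -/
theorem antipodalKleitman_cube {ι : Type*} [Fintype ι] [DecidableEq ι] (f g : Finset ι → ℝ) (hf : Monotone f) (hg : Monotone g) :
    0 ≤ ∑ s : Finset ι, (1 : ℝ) * (f s * (g s - g sᶜ)) := by
  simpa using sum_mul_sub_compl_nonneg f g hf hg

end AntipodalKleitman

section Arc

/-!
### The run poset of an arc is antipodal Kleitman (Theorem PC (i) of the memo, §1h)

For the path `x = p₀ – p₁ – … – p_ℓ = t` (ℓ ≥ 2 edges) a colouring lies on the two-sided frame iff it uses both colours; its doubled state is the pair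
of signed runs `(X,Y)`: `X = +r` if the first `r ≥ 1` edges are red and edge `r+1` is blue (`−r` if blue/red), `Y = +s` if the LAST `s` edges are BLUE
(`−s` if red); the doubled order is the product order on `(ℤ∖0)²`, the colour swap is `(X,Y) ↦ (−X,−Y)`, and the multiplicity of `(X,Y)` is
`2^{ℓ−2−|X|−|Y|}` if `|X|+|Y| ≤ ℓ−2`, `1` on the diagonal `|X|+|Y| = ℓ−1` (only `XY < 0` occurs) and `1` on `|X|+|Y| = ℓ` (only `XY > 0`).  Writing
`F(a,b) := f(a,b)·(g(a,b) − g(−a,−b))`, MASTER⁺ for the arc is the nonnegativity of the diagonal-organised sum in `arc_antipodalKleitman` for all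
`f, g` monotone on `ℤ × ℤ` (every monotone function on the realised sub-poset extends).  Proof: the Klein orbits `(±r,±s)` (`r+s ≤ ℓ−2`) and the
'diamonds' `{(−r,−(s+1)) ≤ (r,−s),(−r,s) ≤ (r,s+1)}` (`r+s = ℓ−1`) plus the leftover pair `{(−(ℓ−1),−1) ≤ (ℓ−1,1)}` partition the state set, and on
each the four-term sum is `(f_M − f_m)(g_M − g_m) + (f_p − f_{p′})(g_p − g_{p′}) ≥ 0` (`diamond_nonneg`).  With `antipodalKleitman_prod` this gives
MASTER⁺ for every theta graph with `S, T` its poles (cycles with any `x ≠ t`, parallel bundles of paths).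
-/

/-- The diamond inequality: in a preorder, if `m ≤ p ≤ M`, `m ≤ p' ≤ M` and `f, g` are monotone then
`f M (g M − g m) + f m (g m − g M) + f p (g p − g p') + f p' (g p' − g p) ≥ 0`
(`= (f M − f m)(g M − g m) + (f p − f p')(g p − g p')` and `f M − f m ≥ |f p − f p'|`). [this work] -/
theorem diamond_nonneg {α : Type*} [Preorder α] (f g : α → ℝ) (hf : Monotone f) (hg : Monotone g)
    {m p p' M : α} (h1 : m ≤ p) (h2 : m ≤ p') (h3 : p ≤ M) (h4 : p' ≤ M) :
    0 ≤ f M * (g M - g m) + f m * (g m - g M) + f p * (g p - g p') + f p' * (g p' - g p) := by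
  have a1 := hf h1; have a2 := hf h2; have a3 := hf h3; have a4 := hf h4
  have b1 := hg h1; have b2 := hg h2; have b3 := hg h3; have b4 := hg h4
  have e : f M * (g M - g m) + f m * (g m - g M) + f p * (g p - g p') + f p' * (g p' - g p) =
      (f M - f m) * (g M - g m) + (f p - f p') * (g p - g p') := by ring
  rw [e]
  nlinarith [mul_nonneg (show 0 ≤ f M - f m - (f p - f p') by linarith) (show 0 ≤ g M - g m - (g p - g p') by linarith),
             mul_nonneg (show 0 ≤ f M - f m + (f p - f p') by linarith) (show 0 ≤ g M - g m + (g p - g p') by linarith)]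

/-- **The arc is antipodal Kleitman** (MASTER⁺ for the path with `S, T` the endpoints, skeleton form).  For `ℓ ≥ 2` and monotone
`f, g : ℤ × ℤ → ℝ`, with `F a b = f (a,b) (g (a,b) − g (−a,−b))`, the multiplicity-weighted sum of `F` over the run poset — interior
`|X|+|Y| ≤ ℓ−2` with weight `2^{ℓ−2−|X|−|Y|}` (all four sign patterns), diagonal `ℓ−1` (patterns `(r,−s),(−r,s)`), diagonal `ℓ` (patterns
`(r,s),(−r,−s)`) — is `≥ 0`. [new] -/
theorem arc_antipodalKleitman (ℓ : ℕ) (hℓ : 2 ≤ ℓ) (f g : ℤ × ℤ → ℝ) (hf : Monotone f) (hg : Monotone g)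
    (F : ℤ → ℤ → ℝ) (hF : ∀ a b, F a b = f (a, b) * (g (a, b) - g (-a, -b))) :
    0 ≤ (∑ r ∈ Finset.Icc 1 ℓ, ∑ s ∈ Finset.Icc 1 ℓ,
            if r + s ≤ ℓ - 2 then (2 : ℝ) ^ (ℓ - 2 - r - s) *
              (F r s + F (-(r : ℤ)) s + F r (-(s : ℤ)) + F (-(r : ℤ)) (-(s : ℤ))) else 0)
        + (∑ r ∈ Finset.Icc 1 (ℓ - 2), (F r (-((ℓ : ℤ) - 1 - r)) + F (-(r : ℤ)) ((ℓ : ℤ) - 1 - r)))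
        + (∑ r ∈ Finset.Icc 1 (ℓ - 1), (F r ((ℓ : ℤ) - r) + F (-(r : ℤ)) (-((ℓ : ℤ) - r)))) := by
  -- (1) interior Klein orbits
  have klein : ∀ r s : ℕ, 1 ≤ r → 1 ≤ s →
      0 ≤ F r s + F (-(r : ℤ)) s + F r (-(s : ℤ)) + F (-(r : ℤ)) (-(s : ℤ)) := by
    intro r s hr hs
    have hr' : (0 : ℤ) < r := by exact_mod_cast hr
    have hs' : (0 : ℤ) < s := by exact_mod_cast hs
    have key := diamond_nonneg f g hf hg (m := ((-(r : ℤ)), (-(s : ℤ)))) (p := ((r : ℤ), (-(s : ℤ))))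
      (p' := ((-(r : ℤ)), (s : ℤ))) (M := ((r : ℤ), (s : ℤ)))
      (Prod.mk_le_mk.2 ⟨by linarith, le_rfl⟩) (Prod.mk_le_mk.2 ⟨le_rfl, by linarith⟩)
      (Prod.mk_le_mk.2 ⟨le_rfl, by linarith⟩) (Prod.mk_le_mk.2 ⟨by linarith, le_rfl⟩)
    rw [hF, hF, hF, hF]
    simp only [neg_neg] at key ⊢
    linarith
  -- (2) diamonds on the diagonals ℓ-1 / ℓ
  have diam : ∀ r : ℕ, 1 ≤ r → r ≤ ℓ - 2 →
      0 ≤ F r (-((ℓ : ℤ) - 1 - r)) + F (-(r : ℤ)) ((ℓ : ℤ) - 1 - r) + (F r ((ℓ : ℤ) - r) + F (-(r : ℤ)) (-((ℓ : ℤ) - r))) := by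
    intro r hr hr2
    have hr' : (0 : ℤ) < r := by exact_mod_cast hr
    have hl : (r : ℤ) ≤ (ℓ : ℤ) - 2 := by
      have : r + 2 ≤ ℓ := by omega
      have : ((r + 2 : ℕ) : ℤ) ≤ (ℓ : ℤ) := by exact_mod_cast this
      push_cast at this; linarith
    have key := diamond_nonneg f g hf hg (m := ((-(r : ℤ)), (-((ℓ : ℤ) - r)))) (p := ((r : ℤ), (-((ℓ : ℤ) - 1 - r))))
      (p' := ((-(r : ℤ)), ((ℓ : ℤ) - 1 - r))) (M := ((r : ℤ), ((ℓ : ℤ) - r)))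
      (Prod.mk_le_mk.2 ⟨by linarith, by linarith⟩) (Prod.mk_le_mk.2 ⟨le_rfl, by linarith⟩)
      (Prod.mk_le_mk.2 ⟨le_rfl, by linarith⟩) (Prod.mk_le_mk.2 ⟨by linarith, by linarith⟩)
    rw [hF, hF, hF, hF]
    have e1 : -(-((ℓ : ℤ) - 1 - r)) = (ℓ : ℤ) - 1 - r := by ring
    have e2 : -(-((ℓ : ℤ) - r)) = (ℓ : ℤ) - r := by ring
    simp only [neg_neg] at key ⊢
    linarith
  -- (3) the leftover chain (ℓ-1, 1)
  have chain : 0 ≤ F ((ℓ - 1 : ℕ) : ℤ) ((ℓ : ℤ) - ((ℓ - 1 : ℕ) : ℤ)) + F (-((ℓ - 1 : ℕ) : ℤ)) (-((ℓ : ℤ) - ((ℓ - 1 : ℕ) : ℤ))) := by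
    rw [hF, hF]
    have hc : ((ℓ - 1 : ℕ) : ℤ) = (ℓ : ℤ) - 1 := by
      have : 1 ≤ ℓ := by omega
      push_cast [Nat.cast_sub this]; ring
    rw [hc]
    have hl1 : (1 : ℤ) ≤ (ℓ : ℤ) - 1 := by
      have : ((2 : ℕ) : ℤ) ≤ (ℓ : ℤ) := by exact_mod_cast hℓ
      push_cast at this; linarith
    have hle : ((-((ℓ : ℤ) - 1)), (-((ℓ : ℤ) - ((ℓ : ℤ) - 1)))) ≤ (((ℓ : ℤ) - 1), ((ℓ : ℤ) - ((ℓ : ℤ) - 1))) :=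
      Prod.mk_le_mk.2 ⟨by linarith, by linarith⟩
    have a := hf hle; have b := hg hle
    simp only [neg_neg]
    nlinarith [mul_nonneg (sub_nonneg.2 a) (sub_nonneg.2 b)]
  -- assemble
  have hsplit : Finset.Icc 1 (ℓ - 1) = insert (ℓ - 1) (Finset.Icc 1 (ℓ - 2)) := by
    ext r; simp only [Finset.mem_insert, Finset.mem_Icc]; omega
  have hnot : (ℓ - 1) ∉ Finset.Icc 1 (ℓ - 2) := by simp only [Finset.mem_Icc]; omega
  rw [hsplit, Finset.sum_insert hnot]
  have t1 : 0 ≤ ∑ r ∈ Finset.Icc 1 ℓ, ∑ s ∈ Finset.Icc 1 ℓ,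
      (if r + s ≤ ℓ - 2 then (2 : ℝ) ^ (ℓ - 2 - r - s) * (F r s + F (-(r : ℤ)) s + F r (-(s : ℤ)) + F (-(r : ℤ)) (-(s : ℤ))) else 0) := by
    refine Finset.sum_nonneg (fun r hr => Finset.sum_nonneg (fun s hs => ?_))
    split_ifs
    · exact mul_nonneg (pow_nonneg (by norm_num) _) (klein r s (Finset.mem_Icc.1 hr).1 (Finset.mem_Icc.1 hs).1)
    · exact le_rfl
  have t23 : 0 ≤ (∑ r ∈ Finset.Icc 1 (ℓ - 2), (F r (-((ℓ : ℤ) - 1 - r)) + F (-(r : ℤ)) ((ℓ : ℤ) - 1 - r)))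
      + ∑ r ∈ Finset.Icc 1 (ℓ - 2), (F r ((ℓ : ℤ) - r) + F (-(r : ℤ)) (-((ℓ : ℤ) - r))) := by
    rw [← Finset.sum_add_distrib]
    exact Finset.sum_nonneg (fun r hr => diam r (Finset.mem_Icc.1 hr).1 (Finset.mem_Icc.1 hr).2)
  linarith [t1, t23, chain]

end Arc

section Comparable

/-- **Comparable partners** (the trivial antipodal-Kleitman blocks: chains, ordinal sums `L₋ ⊕ L₊` with `ι(L₊) = L₋`, lf-2's 'elementary' pairs).
If `ι` is a weight-preserving involution of a finite preorder and every element is comparable with its partner `ι a`, then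
`Σ μ a · f a · (g a − g (ι a)) ≥ 0` for all monotone `f, g` — indeed it equals `½ Σ μ a (f a − f (ι a))(g a − g (ι a))`, a sum of nonnegative terms.
(Tool (T4) of memo FINDING-ANTITHETIC-g17 §1h; used for the leftover chain block of the arc and for the ordinal-sum blocks of trees.) [this work] -/
theorem antipodalKleitman_of_comparable {P : Type*} [Fintype P] [Preorder P] (μ : P → ℝ) (hμ0 : ∀ a, 0 ≤ μ a)
    (ι : P ≃ P) (hι : ∀ a, ι (ι a) = a) (hμ : ∀ a, μ (ι a) = μ a) (hcomp : ∀ a, a ≤ ι a ∨ ι a ≤ a)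
    (f g : P → ℝ) (hf : Monotone f) (hg : Monotone g) :
    0 ≤ ∑ a, μ a * (f a * (g a - g (ι a))) := by
  -- reindex by ι
  have reidx : ∑ a, μ a * (f a * (g a - g (ι a))) = ∑ a, μ a * (f (ι a) * (g (ι a) - g a)) := by
    have h := (Fintype.sum_equiv ι (fun a => μ (ι a) * (f (ι a) * (g (ι a) - g (ι (ι a)))))
      (fun a => μ a * (f a * (g a - g (ι a)))) (fun a => rfl))
    -- h : Σ_a μ(ιa) f(ιa) (g(ιa) − g(ιιa)) = Σ_a μ a f a (g a − g (ι a))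
    rw [← h]
    refine Finset.sum_congr rfl (fun a _ => ?_)
    rw [hμ a, hι a]
  have twice : 2 * ∑ a, μ a * (f a * (g a - g (ι a))) = ∑ a, μ a * ((f a - f (ι a)) * (g a - g (ι a))) := by
    rw [two_mul]
    conv_lhs => rw [reidx]; rw [← reidx]
    rw [show (∑ a, μ a * (f a * (g a - g (ι a)))) + ∑ a, μ a * (f a * (g a - g (ι a))) =
        (∑ a, μ a * (f a * (g a - g (ι a)))) + ∑ a, μ a * (f (ι a) * (g (ι a) - g a)) by rw [← reidx]]
    rw [← Finset.sum_add_distrib]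
    refine Finset.sum_congr rfl (fun a _ => by ring)
  have hsum : 0 ≤ ∑ a, μ a * ((f a - f (ι a)) * (g a - g (ι a))) := by
    refine Finset.sum_nonneg (fun a _ => mul_nonneg (hμ0 a) ?_)
    rcases hcomp a with h | h
    · have h1 := hf h; have h2 := hg h
      nlinarith
    · have h1 := hf h; have h2 := hg h
      nlinarith
  linarith

end Comparable

end AntitheticProduct

end Summit.CriticalPhenomena.PercolationContinuityZ3.Theorems
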